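import Mathlib
import HarnessLib
import Summits.HubbardSuperconductivity.HubbardSuperconductivity.Theorems.KLProgrammeKLRegimeAlphaFatScalars2

/-!
# Route `KLProgramme` — engine support, route (L2), FAT layer, WEIGHTED: scalar inequalities for the closed form of `α_w` — the WEIGHTED
# additive weight sum in canonical rates and the final product

Cell `gate-hubbard-kl`, seat p3 (g10); program «W3α = α_w rows instance», file (α2s) — the weighted companions of k3c2-p3's `wBracket_le` /
`alphaProduct_le` (`…AlphaFatScalars2`):

* `wBracketWt_le` — the weighted radicand `524288(1/s₀+1)((1 + 2√2s₁/(s₂(N_r−1)) + 2√2s₁/(s₃′(N_r−1)))²·P + Q)` (`P, Q` the near bracket and the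
  far term of `wBracket_le`) is `≤ 64(1+f₂+f₃)²` times the bound of `wBracket_le`, given `2√2s₁/(s₂(N_r−1)) ≤ f₂`, `2√2s₁/(s₃′(N_r−1)) ≤ f₃`;
* `alphaProductWt_le` — `√W·√(24·2M·L²·N̄_s)·((βL²)⁻²·4βL²/Λ) ≤ 4√(48·C_W·C_N)·(M/β)/Λ`.

Pure real algebra; no definitions. [folklore]
-/

noncomputable section

namespace Summit.HubbardSuperconductivity.HubbardSuperconductivity.Theorems.TorusFourierL2

set_option linter.dupNamespace false -- summit = problem name (single-conjunct summit), D-0017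

/-- **The weighted additive weight sum with canonical rates** (see the module docstring). [folklore] -/
theorem wBracketWt_le {s₀ s₁ s₂ s₃ s₃' Nr R₀ Λ e₀ Mβ x₀ x₁ x₂ x₃ δL L f₂ f₃ : ℝ} (hs₀ : 0 < s₀) (hs₁ : 0 < s₁) (hs₂ : 0 < s₂) (hs₃ : 0 < s₃)
    (hs₃' : 0 < s₃') (hΛ : 0 < Λ) (hΛe : Λ ≤ e₀) (he₁ : e₀ ≤ 1) (hNr : 2 ≤ Nr) (hMβ : 0 ≤ Mβ) (hx₀ : 0 ≤ x₀) (hx₂ : 0 ≤ x₂) (hx₃ : 0 ≤ x₃)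
    (hδL : 0 < δL) (hL : 0 < L)
    (h0 : 1 / s₀ = x₀ * Mβ / Λ) (h0' : 1 ≤ 1 / s₀) (h1 : 1 / s₁ = x₁ / Λ)
    (h2 : 1 / (s₂ * (Nr - 1)) ≤ x₂ / Λ) (h3 : 1 / (s₃ * (Nr - 1)) ≤ x₃ * Nr) (hΛL : δL ≤ Λ ^ 2 * L) (hR₀ : L / (10 * Nr) ≤ R₀)
    (hf₂0 : 0 ≤ f₂) (hf₃0 : 0 ≤ f₃) (hf₂ : 2 * Real.sqrt 2 * s₁ / (s₂ * (Nr - 1)) ≤ f₂) (hf₃ : 2 * Real.sqrt 2 * s₁ / (s₃' * (Nr - 1)) ≤ f₃) :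
    524288 * (1 / s₀ + 1) *
        ((1 + 2 * Real.sqrt 2 * s₁ / (s₂ * (Nr - 1)) + 2 * Real.sqrt 2 * s₁ / (s₃' * (Nr - 1))) ^ 2 *
            ((2 * Real.sqrt 2 / (s₂ * (Nr - 1)) + 2) * (2 * Real.sqrt 2 / (s₃ * (Nr - 1)) + 2)) +
          (1 / s₁ + 1) ^ 2 / (1 + s₁ * R₀)) ≤
      64 * (1 + f₂ + f₃) ^ 2 *
        (4096 * x₀ * (4 * ((2 * Real.sqrt 2 * x₂ + 2) * (2 * Real.sqrt 2 * x₃ + 1)) + 160 * x₁ * (x₁ + 1) ^ 2 / δL) * Mβ * Nr / Λ ^ 2) := by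
  have hW := wBracket_le hs₀ hs₁ hs₂ hs₃ hΛ hΛe he₁ hNr hMβ hx₀ hx₂ hx₃ hδL hL h0 h0' h1 h2 h3 hΛL hR₀
  have hNr1 : 0 < Nr - 1 := by linarith only [hNr]
  have hR₀0 : 0 ≤ R₀ := le_trans (by positivity) hR₀
  set F : ℝ := 1 + 2 * Real.sqrt 2 * s₁ / (s₂ * (Nr - 1)) + 2 * Real.sqrt 2 * s₁ / (s₃' * (Nr - 1)) with hF
  set P : ℝ := (2 * Real.sqrt 2 / (s₂ * (Nr - 1)) + 2) * (2 * Real.sqrt 2 / (s₃ * (Nr - 1)) + 2) with hP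
  set Q : ℝ := (1 / s₁ + 1) ^ 2 / (1 + s₁ * R₀) with hQ
  have hF0 : 0 ≤ F := by positivity
  have hFb : F ≤ 1 + f₂ + f₃ := by rw [hF]; linarith only [hf₂, hf₃]
  have hFb1 : 1 ≤ 1 + f₂ + f₃ := by linarith only [hf₂0, hf₃0]
  have hP0 : 0 ≤ P := by positivity
  have hQ0 : 0 ≤ Q := by positivity
  have hpre0 : 0 ≤ 1 / s₀ + 1 := by positivity
  have hF2 : F ^ 2 ≤ (1 + f₂ + f₃) ^ 2 := pow_le_pow_left₀ hF0 hFb 2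
  have hFb2 : 1 ≤ (1 + f₂ + f₃) ^ 2 := by nlinarith only [hFb1]
  have hin : F ^ 2 * P + Q ≤ (1 + f₂ + f₃) ^ 2 * ((4 * P + 16 * Q) / 4) := by
    have t1 : F ^ 2 * P ≤ (1 + f₂ + f₃) ^ 2 * P := mul_le_mul_of_nonneg_right hF2 hP0
    have t2 : Q ≤ (1 + f₂ + f₃) ^ 2 * Q := le_mul_of_one_le_left hQ0 hFb2
    have t3 : 0 ≤ (1 + f₂ + f₃) ^ 2 * Q := by positivity
    have e : (1 + f₂ + f₃) ^ 2 * ((4 * P + 16 * Q) / 4) = (1 + f₂ + f₃) ^ 2 * P + (1 + f₂ + f₃) ^ 2 * Q + 3 * ((1 + f₂ + f₃) ^ 2 * Q) := by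
      ring
    rw [e]; linarith [t1, t2, t3]
  calc 524288 * (1 / s₀ + 1) * (F ^ 2 * P + Q)
      ≤ 524288 * (1 / s₀ + 1) * ((1 + f₂ + f₃) ^ 2 * ((4 * P + 16 * Q) / 4)) := mul_le_mul_of_nonneg_left hin (by positivity)
    _ = 64 * (1 + f₂ + f₃) ^ 2 * (2048 * (1 / s₀ + 1) * (4 * P + 16 * (1 / s₁ + 1) ^ 2 / (1 + s₁ * R₀))) := by
        simp only [hQ]; ring
    _ ≤ 64 * (1 + f₂ + f₃) ^ 2 *
        (4096 * x₀ * (4 * ((2 * Real.sqrt 2 * x₂ + 2) * (2 * Real.sqrt 2 * x₃ + 1)) + 160 * x₁ * (x₁ + 1) ^ 2 / δL) * Mβ * Nr / Λ ^ 2) :=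
        mul_le_mul_of_nonneg_left hW (by positivity)

/-- **The final product (weighted support factor `24`)**: if `W ≤ C_W·(M/β)·N_r/Λ²` and `N̄_s ≤ C_N·βL²Λ²/N_r`, then
`√W·√(24·2M·L²·N̄_s)·((βL²)⁻²·4βL²/Λ) ≤ 4√(48·C_W·C_N)·(M/β)/Λ`. [folklore] -/
theorem alphaProductWt_le {W Ns CW CN M β L Λ Nr : ℝ} (hW0 : 0 ≤ W) (hNs0 : 0 ≤ Ns) (hCW : 0 ≤ CW) (hCN : 0 ≤ CN) (hM : 0 < M) (hβ : 0 < β)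
    (hL : 0 < L) (hΛ : 0 < Λ) (hNr : 0 < Nr) (hW : W ≤ CW * (M / β) * Nr / Λ ^ 2) (hNs : Ns ≤ CN * (β * L ^ 2 * Λ ^ 2 / Nr)) :
    Real.sqrt W * Real.sqrt (24 * (2 * M) * L ^ 2 * Ns) * ((1 / (β * L ^ 2)) ^ 2 * (4 * (β * L ^ 2) / Λ)) ≤
      4 * Real.sqrt (48 * CW * CN) * (M / β) / Λ := by
  have h1 : Real.sqrt W * Real.sqrt (24 * (2 * M) * L ^ 2 * Ns) = Real.sqrt (W * (24 * (2 * M) * L ^ 2 * Ns)) :=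
    (Real.sqrt_mul hW0 _).symm
  rw [h1]
  have h2 : W * (24 * (2 * M) * L ^ 2 * Ns) ≤ (CW * (M / β) * Nr / Λ ^ 2) * (24 * (2 * M) * L ^ 2 * (CN * (β * L ^ 2 * Λ ^ 2 / Nr))) :=
    mul_le_mul hW (by gcongr) (by positivity) (by positivity)
  have h3 : (CW * (M / β) * Nr / Λ ^ 2) * (24 * (2 * M) * L ^ 2 * (CN * (β * L ^ 2 * Λ ^ 2 / Nr))) = (Real.sqrt (48 * CW * CN) * M * L ^ 2) ^ 2 := by
    rw [mul_pow, mul_pow, Real.sq_sqrt (by positivity)]; field_simp; ring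
  have h4 : Real.sqrt (W * (24 * (2 * M) * L ^ 2 * Ns)) ≤ Real.sqrt (48 * CW * CN) * M * L ^ 2 := by
    rw [← Real.sqrt_sq (by positivity : 0 ≤ Real.sqrt (48 * CW * CN) * M * L ^ 2), ← h3]
    exact Real.sqrt_le_sqrt h2
  calc Real.sqrt (W * (24 * (2 * M) * L ^ 2 * Ns)) * ((1 / (β * L ^ 2)) ^ 2 * (4 * (β * L ^ 2) / Λ))
      ≤ (Real.sqrt (48 * CW * CN) * M * L ^ 2) * ((1 / (β * L ^ 2)) ^ 2 * (4 * (β * L ^ 2) / Λ)) :=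
        mul_le_mul_of_nonneg_right h4 (by positivity)
    _ = 4 * Real.sqrt (48 * CW * CN) * (M / β) / Λ := by field_simp

/-- **A cube dominates below a `max 1`**: `q ≤ (max 1 q)³` and `0 < max 1 q`. [folklore] -/
theorem le_max_one_pow_three (q : ℝ) : q ≤ (max 1 q) ^ 3 ∧ 0 < max 1 q := by
  have h1 : 1 ≤ max 1 q := le_max_left _ _
  have hq : q ≤ max 1 q := le_max_right _ _
  refine ⟨hq.trans ?_, lt_of_lt_of_le one_pos h1⟩
  calc max 1 q = max 1 q * 1 * 1 := by ring
    _ ≤ max 1 q * max 1 q * max 1 q := by gcongr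
    _ = (max 1 q) ^ 3 := by ring

end Summit.HubbardSuperconductivity.HubbardSuperconductivity.Theorems.TorusFourierL2

end
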